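import Summits.CriticalPhenomena.PercolationContinuityZ3.Theorems.SahiCISCylinder

/-!
# The cylinder criterion, converse: a.e.-kernel CIS implies condition (c); the equivalence for atomless marginals

Cell `prim-sahi`, typer (generation 17); `--supports stmt-CriticalPhenomena-4575`.  Theorems only (no definitions, no
named facts, no sorries).  Completes `SahiCISCylinder.lean`:

* `measure_upperSet_le_of_Iic_le` — on `[0,1]`, cdf domination `Q([0,x]) ≤ P([0,x])` (all `x`) gives `P(V) ≤ Q(V)`
  for every measurable upper set `V` (quantile coupling of `SahiLiebSahiContinuumProduct.lean`).
* **`condIncrLast_of_aepairMonoKernel`**, **`IsCISae.condIncrLast`** — if the last coordinate of a probability law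
  `μ` on `Q_{d+1}` admits a disintegration kernel that is stochastically increasing on almost every comparable pair
  (in particular if `μ` is `IsCISae (d+1)`), then Colangelo–Müller–Scarsini's condition (c) `CondIncrLast μ` holds:
  `µ(A × V) µ^{(d)}(B) ≤ µ(B × V) µ^{(d)}(A)` for strictly separated closed boxes `A < B` and upper `V` (Tonelli on
  `A × B`: every pair there is comparable).  **`IsCISae.isCIScyl`** — at every level.
* **`isCISae_succ_iff_condIncrLast_of_noAtoms`**, **`isCISae_iff_isCIScyl_of_noAtoms`** — for laws whose
  one-dimensional marginals have no atoms, condition (c) (all levels) is EQUIVALENT to CIS in the a.e.-kernel sense;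
  **`isCISae_two_iff_condIncrLast`** — on `Q_2` unconditionally.  So the defect of Definition 4 / Theorem 4 in
  dimension `≥ 3` (`SahiCISDefinitionFour.lean`) is exactly a matter of atoms shared by comparable conditioning points.

References: Colangelo–Müller–Scarsini 2006, Thm. 4 [ColangeloMullerScarsini2006].  Statements are this work.
-/

noncomputable section

namespace Summit.CriticalPhenomena.PercolationContinuityZ3.Theorems.SahiCIS

open MeasureTheory ProbabilityTheory Set Filter Topology Function
open Summit.CriticalPhenomena.PercolationContinuityZ3.Theorems.SahiBoxTP2
open scoped ENNReal unitInterval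

variable {d : ℕ}

/-! ### cdf domination ⇒ domination on upper sets, on `[0,1]` -/

/-- On `[0,1]`: if `Q([0,x]) ≤ P([0,x])` for all `x`, then `P(V) ≤ Q(V)` for every measurable upper set `V` (couple
both to Lebesgue measure by quantiles, which are then ordered pointwise). [folklore] -/
theorem measure_upperSet_le_of_Iic_le (P Q : Measure I) [IsProbabilityMeasure P] [IsProbabilityMeasure Q]
    (h : ∀ x : I, Q (Iic x) ≤ P (Iic x)) {V : Set I} (hV : IsUpperSet V) (hVm : MeasurableSet V) : P V ≤ Q V := by
  rw [← UnitIntervalQuantile.map_quantile_volume P, ← UnitIntervalQuantile.map_quantile_volume Q,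
    Measure.map_apply (UnitIntervalQuantile.measurable_quantile P) hVm,
    Measure.map_apply (UnitIntervalQuantile.measurable_quantile Q) hVm]
  exact measure_mono fun u hu => hV (UnitIntervalQuantile.quantile_mono_measure P Q h u) hu

/-! ### a.e.-kernel CIS ⇒ condition (c) -/

/-- **A disintegration kernel stochastically increasing on almost every pair gives condition (c)** for the last
coordinate: for closed boxes `A = [a,c]`, `B = [a',c']` over the first `d` coordinates with `c_i < a'_i` and every
measurable upper `V ⊆ [0,1]`, `µ(A × V) µ^{(d)}(B) ≤ µ(B × V) µ^{(d)}(A)`. [this work] -/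
theorem condIncrLast_of_aepairMonoKernel (μ : Measure (Fin (d + 1) → I)) [IsProbabilityMeasure μ]
    (κ : Kernel (Fin d → I) I) [IsMarkovKernel κ] (hdis : (μ.map initLast).fst ⊗ₘ κ = μ.map initLast)
    (hmono : AEPairMonoKernel (μ.map initLast).fst κ) : CondIncrLast μ := by
  intro a c a' c' hsep V hV hVm
  set ν := (μ.map initLast).fst with hν
  haveI : IsProbabilityMeasure ν := by rw [hν]; infer_instance
  set A : Set (Fin d → I) := Icc a c with hA
  set B : Set (Fin d → I) := Icc a' c' with hB
  have hAm : MeasurableSet A := measurableSet_Icc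
  have hBm : MeasurableSet B := measurableSet_Icc
  have hκV : Measurable fun x : Fin d → I => κ x V := κ.measurable_coe hVm
  -- the two sides as product integrals over `A × B`
  rw [← hdis, Measure.compProd_apply_prod hAm hVm, Measure.compProd_apply_prod hBm hVm]
  have hAB : ∀ p : (Fin d → I) × (Fin d → I), p ∈ A ×ˢ B → p.1 ≤ p.2 := fun p hp i =>
    (hp.1.2 i).trans ((le_of_lt (hsep i)).trans (hp.2.1 i))
  have hleft : (∫⁻ x in A, κ x V ∂ν) * ν B = ∫⁻ p in A ×ˢ B, κ p.1 V ∂(ν.prod ν) := by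
    rw [← Measure.prod_restrict,
      lintegral_prod (fun p : (Fin d → I) × (Fin d → I) => κ p.1 V) (hκV.comp measurable_fst).aemeasurable]
    simp only [lintegral_const, Measure.restrict_apply MeasurableSet.univ, univ_inter]
    rw [lintegral_mul_const _ hκV]
  have hright : (∫⁻ x in B, κ x V ∂ν) * ν A = ∫⁻ p in A ×ˢ B, κ p.2 V ∂(ν.prod ν) := by
    rw [← Measure.prod_restrict,
      lintegral_prod (fun p : (Fin d → I) × (Fin d → I) => κ p.2 V) (hκV.comp measurable_snd).aemeasurable]
    simp only [lintegral_const, Measure.restrict_apply MeasurableSet.univ, univ_inter]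
  rw [hleft, hright]
  refine lintegral_mono_ae ?_
  have hae : ∀ᵐ p ∂(ν.prod ν), p ∈ A ×ˢ B → κ p.1 V ≤ κ p.2 V := by
    filter_upwards [hmono] with p hp hpAB
    exact measure_upperSet_le_of_Iic_le (κ p.1) (κ p.2) (hp (hAB p hpAB)) hV hVm
  exact (ae_restrict_iff' (hAm.prod hBm)).2 hae

/-- **`IsCISae (d+1)` implies condition (c) for the last coordinate.** [this work] -/
theorem IsCISae.condIncrLast (μ : Measure (Fin (d + 1) → I)) [IsProbabilityMeasure μ] (hμ : IsCISae (d + 1) μ) :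
    CondIncrLast μ := by
  obtain ⟨-, κ, hκ, hdis, hmono⟩ := hμ
  exact condIncrLast_of_aepairMonoKernel μ κ hdis hmono

/-- **`IsCISae d` implies condition (c) at every level.** [this work] -/
theorem IsCISae.isCIScyl : ∀ (d : ℕ) (μ : Measure (Fin d → I)) [IsProbabilityMeasure μ], IsCISae d μ → IsCIScyl d μ := by
  intro d
  induction d with
  | zero => intro μ _ _; trivial
  | succ d ih => intro μ _ hμ; exact ⟨ih _ hμ.1, hμ.condIncrLast μ⟩

/-! ### The equivalence for atomless marginals, and in dimension 2 -/

/-- **One level, atomless conditioning coordinates**: `IsCISae (d+1) μ ↔ IsCISae d µ^{(d)} ∧ CondIncrLast μ`.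
[this work] -/
theorem isCISae_succ_iff_condIncrLast_of_noAtoms (μ : Measure (Fin (d + 1) → I)) [IsProbabilityMeasure μ]
    (hna : ∀ (i : Fin d) (x : I), (μ.map initLast).fst {a | a i = x} = 0) :
    IsCISae (d + 1) μ ↔ IsCISae d (μ.map initLast).fst ∧ CondIncrLast μ :=
  ⟨fun h => ⟨h.1, h.condIncrLast μ⟩, fun h => isCISae_succ_of_condIncrLast_of_noAtoms μ h.1 h.2 hna⟩

/-- **All levels, atomless one-dimensional marginals: condition (c) ⟺ CIS in the a.e.-kernel sense.** [this work] -/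
theorem isCISae_iff_isCIScyl_of_noAtoms (μ : Measure (Fin d → I)) [IsProbabilityMeasure μ]
    (hna : ∀ (i : Fin d) (x : I), μ {z | z i = x} = 0) : IsCISae d μ ↔ IsCIScyl d μ :=
  ⟨IsCISae.isCIScyl d μ, fun h => IsCIScyl.isCISae_of_noAtoms d μ h hna⟩

/-- **Dimension 2, no hypothesis: condition (c) ⟺ CIS** (one conditioning coordinate). [this work] -/
theorem isCISae_two_iff_condIncrLast (μ : Measure (Fin 2 → I)) [IsProbabilityMeasure μ] :
    IsCISae 2 μ ↔ CondIncrLast μ :=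
  ⟨fun h => h.condIncrLast μ, isCISae_two_of_condIncrLast μ⟩

end Summit.CriticalPhenomena.PercolationContinuityZ3.Theorems.SahiCIS

end
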